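import Summits.QuantumFields.YangMills.Theorems.BalabanLadderUVSeamRecGaussianCalibrationOperatorBound
import HarnessLib

/-!
# Crux `UVSeamRec` (stmt-QuantumFields-20043), free-field calibration of (RM), file 3d (final): the response-moment law (RM), the
# linear-source law (EM_lin)/(GD) and the exp-square law (EM_Q) HOLD for the massless lattice free field of `ℤ⁴`

Helper file (`--supports stmt-QuantumFields-20043`) of the seam seat `ym-20043-seam-s2` (gen 3); theorems only, no definitions.

WHAT.  The registered v5(α) stub `BirthV5A.stub_responseMomentsOdd6 : UV → (RM)` (owner R86k, slot afcf556d5b76a240) asks, at the unit of record and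
for `SU(2)` Wilson theory, the joint exponential RESPONSE MOMENTS `⟨exp(Σ_{i∈T} (R⁴/C₁)|kerE_i − p_i|)⟩ ≤ e^{B·#T}` over cyclically `2R+4`-separated
families of cubes of side `2R+3`, uniformly in the scale `R ≤ ℓ₁/a(β)`.  Its documented discharge architecture (β-cl) (LEAD g8: p544631/p545723/p548409,
ceilings-p2 p535725/p541348) is: (split) kernel response ≤ classical carrier + influence; (EM_lin) an extensive sub-Gaussian law in LINEAR sources for the
carrier — an ℓ² OPERATOR bound, not an ℓ¹ budget (ceilings-p2 #54 §2); Hubbard–Stratonovich ⇒ (EM_Q); ⇒ (RM).  THIS SERIES (files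
`…GaussianCalibrationKernel` / `…Energy` / `…Moments` / `…Cubes` / `…OperatorBound` / this file) proves that the whole architecture and its output (RM)
HOLD in the free field — the lattice GFF `ν` of `ℤ⁴` (tree `IsDiscreteGFF`, covariance `latticeGreen/2`), with `kerE_i` replaced by its free-field analogue:
the squared centre gradient `Q_i = (∇_{j_i} h_i(x_i))²` of the harmonic extension `h_i = φ − dirichletField Λ_i φ` of the exterior field into the cube
`Λ_i = x_i + sbox(R+1)` (by the domain Markov property `Q_i + Var(∇ψ^{Λ_i})` IS the conditional expectation of `(∇_{j_i}φ(x_i))²` given the field off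
`Λ_i`), centred at its mean `∫Q_i ≤ v/R⁴`:
* `gff_linearSourceLaw` — (EM_lin)/(GD): `∫ exp(Σ tᵢ·R²∇h_i(x_i)) dν ≤ exp((v/2)Σtᵢ²)`, ABSOLUTE `v`, all `R ≥ 1`, all separated families;
* `gff_expSquareLaw` — (EM_Q): `∫ exp(λ Σ (R²∇h_i(x_i))²) dν ≤ (2(1−2λv)^{-1/2})^{#ι}` for `2λv < 1` (with integrability);
* `gff_integral_centreGradient_sq_le` — the `R⁻⁴` law `∫ (∇h(x))² dν ≤ v/R⁴`;
* **`gff_responseMoments`** — (RM): `∫ exp(Σ_{i∈T} (R⁴/C₁)|Q_i − ∫Q_i|) dν ≤ exp(B·#T)`, `C₁ = 4v`, `B = ¼ + log(2√2)`, all `R ≥ 1`, all `n`, all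
  `2R+4`-separated centres, all sub-families `T` — the statement of `ResponseMomentsDefs.ResponseMomentsOdd6SU2` with (Wilson state, torus, `kerE`)
  replaced by (GFF, `ℤ⁴`, `Q`).
LOCATED CONTENT for the owner/LEAD: the (RM)/(β-cl) currency of record is GAUSSIAN-CONSISTENT at every scale with β-, R- and family-uniform constants,
and the `Σtᵢ²` structure of (EM_lin) is realised by DISJOINT INTERIOR FLUXES of energy `O(R⁻⁴)` (file 1) + the energy inequality (file 2) — the
free-field form of the "separated-family operator bound" (LEAD g8 HANDOFF, next step (3)); contrast: rate-`R⁻⁴` RARITY currencies fail already in the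
free field (ceilings-p2 #54, tempered-d1 OBJECTION-top-scale).

No sorry, standard axioms.  HONEST FRAMING: theorems about the massless lattice FREE field; a consistency CALIBRATION of one OPEN binder of a
CONDITIONAL chain; nothing of E0′ or of the interacting theory is proved; not a gap, not Clay.
References: Friedli–Velenik 2017, Ch. 8 (GFF, Thm. 8.21 Markov property); Vershynin 2018, Lemma 2.7.6 (sub-Gaussian squares).
-/

set_option autoImplicit false

noncomputable section

open MeasureTheory ProbabilityTheory Finset
open Literature.Probability.LatticeModels
open Literature.MathematicalPhysics.QuantumFieldTheory.LatticeForm (e)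
open Summit.QuantumFields.YangMills.Theorems.WeakCouplingRates.HarmonicInterior

namespace Summit.QuantumFields.YangMills.Cruxes.UVSeamRec.GaussianCalibration

/-! ## §5 The free-field calibration theorems: (EM_lin)/(GD), (EM_Q) and (RM) in the lattice GFF of `ℤ⁴` -/

section Law

variable {ν : Measure (Site 4 → ℝ)}

/-- **The response carrier as a boundary linear statistic on the common carrier**: for `R ≥ 1`, cube `Λ_i = x_i + sbox(R+1)` and the carrier
`S = ⋃_{i'} (x_{i'} + sbox (R+2))`, `R²·∇_{j}(φ − ψ^{Λ_i})(x_i) = Σ_{w ∈ S} R²(H_{Λ_i}(x_i + e_j, w) − H_{Λ_i}(x_i, w)) φ_w`. [folklore] -/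
theorem responseCarrier_eq_linStat {R : ℕ} (hR : 1 ≤ R) {ι : Type} [Fintype ι] (j : ι → Fin 4) (x : ι → Site 4) (i : ι)
    (φ : Site 4 → ℝ) :
    (R : ℝ) ^ 2 * ((φ (x i + e (j i)) - dirichletField ((sbox (R + 1)).image (fun z => x i + z)) φ (x i + e (j i))) -
        (φ (x i) - dirichletField ((sbox (R + 1)).image (fun z => x i + z)) φ (x i))) =
      ∑ w ∈ Finset.univ.biUnion (fun i' => (sbox (R + 2)).image (fun z => x i' + z)),
        ((R : ℝ) ^ 2 * (Literature.Probability.LatticeModels.poissonKernel ((sbox (R + 1)).image (fun z => x i + z)) (x i + e (j i)) w -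
          Literature.Probability.LatticeModels.poissonKernel ((sbox (R + 1)).image (fun z => x i + z)) (x i) w)) * φ w := by
  classical
  set Λ : Finset (Site 4) := (sbox (R + 1)).image (fun z => x i + z) with hΛ
  set S : Finset (Site 4) := Finset.univ.biUnion (fun i' => (sbox (R + 2)).image (fun z => x i' + z)) with hS
  have hbdS : outerBoundary (zdGraph 4) Λ ⊆ S := (outerBoundary_image_sbox_subset (R + 1) (x i)).trans
    (Finset.subset_biUnion_of_mem (fun i' => (sbox (R + 2)).image (fun z => x i' + z)) (Finset.mem_univ i))
  have hxΛ : x i ∈ Λ := by have h := add_mem_image_sbox (x i) (zero_mem_sbox (R + 1)); rwa [add_zero] at h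
  have hxeΛ : x i + e (j i) ∈ Λ := add_mem_image_sbox (x i) (e_mem_sbox (by omega) (j i))
  rw [sub_dirichletField_eq_sum hbdS φ hxeΛ, sub_dirichletField_eq_sum hbdS φ hxΛ, ← Finset.sum_sub_distrib, Finset.mul_sum]
  exact Finset.sum_congr rfl fun w _ => by ring

/-- **(EM_lin)/(GD) in the free field — the linear-source law of the response carriers.**  For the lattice GFF `ν` of `ℤ⁴` there is an
ABSOLUTE `v > 0` such that for every `R ≥ 1`, every family of cubes `x_i + sbox(R+1)` with centres pairwise `2R+4`-separated in some coordinate,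
all directions `j_i` and all real sources `t_i`:
`∫ exp(Σ_i t_i · R²∇_{j_i}(φ − ψ^{Λ_i})(x_i)) dν ≤ exp((v/2) Σ_i t_i²)` —
the free-field twin of `ClassicalResponse.GaussianDominationSU2` / `ClassicalResponse.EMLin` (with `m = 0`), uniformly in `R` and the family.
[cite: FriedliVelenik2017, Ch. 8 Thm. 8.21] -/
theorem gff_linearSourceLaw (hν : IsDiscreteGFF ν (coordProc 4)) :
    ∃ v : ℝ, 0 < v ∧ ∀ (R : ℕ), 1 ≤ R → ∀ (ι : Type) [Fintype ι] (j : ι → Fin 4) (x : ι → Site 4),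
      (∀ i i' : ι, i ≠ i' → ∃ k : Fin 4, 2 * (R : ℤ) + 4 ≤ |x i k - x i' k|) → ∀ t : ι → ℝ,
      ∫ φ, Real.exp (∑ i, t i * ((R : ℝ) ^ 2 *
          ((φ (x i + e (j i)) - dirichletField ((sbox (R + 1)).image (fun z => x i + z)) φ (x i + e (j i))) -
           (φ (x i) - dirichletField ((sbox (R + 1)).image (fun z => x i + z)) φ (x i))))) ∂ν ≤
        Real.exp (v / 2 * ∑ i, (t i) ^ 2) := by
  classical
  obtain ⟨v, hv0, hv⟩ := exists_sq_integral_responseCarrier_le hν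
  refine ⟨v, hv0, fun R hR ι _ j x hsep t => ?_⟩
  set S : Finset (Site 4) := Finset.univ.biUnion (fun i' => (sbox (R + 2)).image (fun z => x i' + z)) with hS
  set a : Site 4 → ℝ := fun w => ∑ i, t i * ((R : ℝ) ^ 2 *
    (Literature.Probability.LatticeModels.poissonKernel ((sbox (R + 1)).image (fun z => x i + z)) (x i + e (j i)) w -
      Literature.Probability.LatticeModels.poissonKernel ((sbox (R + 1)).image (fun z => x i + z)) (x i) w)) with ha
  have hY : ∀ φ : Site 4 → ℝ, ∑ i, t i * ((R : ℝ) ^ 2 *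
      ((φ (x i + e (j i)) - dirichletField ((sbox (R + 1)).image (fun z => x i + z)) φ (x i + e (j i))) -
       (φ (x i) - dirichletField ((sbox (R + 1)).image (fun z => x i + z)) φ (x i)))) = ∑ w ∈ S, a w * φ w := by
    intro φ
    simp_rw [responseCarrier_eq_linStat hR j x _ φ, Finset.mul_sum]
    rw [Finset.sum_comm]
    refine Finset.sum_congr rfl fun w _ => ?_
    simp only [ha, Finset.sum_mul]
    exact Finset.sum_congr rfl fun i _ => by ring
  have h1 := hv R hR ι j x hsep t
  simp_rw [hY] at h1 ⊢
  rw [integral_exp_linStat hν (by norm_num) S a]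
  rw [integral_linStat_sq hν S a] at h1
  exact Real.exp_le_exp.2 (by linarith)

/-- **(EM_Q) in the free field — joint exponential moments of the SQUARED response carriers.**  With the absolute `v` of the linear-source law:
for every `λ ≥ 0` with `2λv < 1`, every `R ≥ 1` and every `2R+4`-separated family, `exp(λ Σ_i (R²∇_{j_i}(φ − ψ^{Λ_i})(x_i))²)` is ν-integrable and
`∫ exp(λ Σ_i (R²∇_{j_i}(φ − ψ^{Λ_i})(x_i))²) dν ≤ (2(1 − 2λv)^{-1/2})^{#ι}` — the free-field twin of the hypothesis (EM_Q) of
`TemperedResponse.responseMoments_of_quadratic_and_polymerLaw` (p535725) for the quadratic carrier `Q = λ·L²`. [folklore] -/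
theorem gff_expSquareLaw (hν : IsDiscreteGFF ν (coordProc 4)) :
    ∃ v : ℝ, 0 < v ∧ ∀ (lam : ℝ), 0 ≤ lam → 2 * lam * v < 1 → ∀ (R : ℕ), 1 ≤ R →
      ∀ (ι : Type) [Fintype ι] (j : ι → Fin 4) (x : ι → Site 4),
      (∀ i i' : ι, i ≠ i' → ∃ k : Fin 4, 2 * (R : ℤ) + 4 ≤ |x i k - x i' k|) →
      Integrable (fun φ : Site 4 → ℝ => Real.exp (lam * ∑ i, ((R : ℝ) ^ 2 *
          ((φ (x i + e (j i)) - dirichletField ((sbox (R + 1)).image (fun z => x i + z)) φ (x i + e (j i))) -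
           (φ (x i) - dirichletField ((sbox (R + 1)).image (fun z => x i + z)) φ (x i)))) ^ 2)) ν ∧
      ∫ φ, Real.exp (lam * ∑ i, ((R : ℝ) ^ 2 *
          ((φ (x i + e (j i)) - dirichletField ((sbox (R + 1)).image (fun z => x i + z)) φ (x i + e (j i))) -
           (φ (x i) - dirichletField ((sbox (R + 1)).image (fun z => x i + z)) φ (x i)))) ^ 2) ∂ν ≤
        (2 * Real.sqrt (1 / (1 - 2 * (lam * v)))) ^ Fintype.card ι := by
  classical
  obtain ⟨v, hv0, hv⟩ := exists_sq_integral_responseCarrier_le hν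
  refine ⟨v, hv0, fun lam hlam h2 R hR ι _ j x hsep => ?_⟩
  set S : Finset (Site 4) := Finset.univ.biUnion (fun i' => (sbox (R + 2)).image (fun z => x i' + z)) with hS
  set a : ι → Site 4 → ℝ := fun i w => (R : ℝ) ^ 2 *
    (Literature.Probability.LatticeModels.poissonKernel ((sbox (R + 1)).image (fun z => x i + z)) (x i + e (j i)) w -
      Literature.Probability.LatticeModels.poissonKernel ((sbox (R + 1)).image (fun z => x i + z)) (x i) w) with ha
  have hL : ∀ (i : ι) (φ : Site 4 → ℝ), (R : ℝ) ^ 2 *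
      ((φ (x i + e (j i)) - dirichletField ((sbox (R + 1)).image (fun z => x i + z)) φ (x i + e (j i))) -
       (φ (x i) - dirichletField ((sbox (R + 1)).image (fun z => x i + z)) φ (x i))) = ∑ w ∈ S, a i w * φ w :=
    fun i φ => responseCarrier_eq_linStat hR j x i φ
  have hvar : ∀ t : ι → ℝ, ∫ φ, (∑ i, t i * ∑ w ∈ S, a i w * φ w) ^ 2 ∂ν ≤ v * ∑ i, (t i) ^ 2 := by
    intro t
    have h := hv R hR ι j x hsep t
    simp_rw [hL] at h
    exact h
  have h := integral_exp_mul_sum_sq_le_of_sq_le hν (by norm_num) S a hlam h2 hvar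
  simp_rw [hL]
  exact h

/-- **The `R⁻⁴` law of the free-field response (second moment)**: `∫ (∇_j(φ − ψ^{Λ})(x))² dν ≤ v/R⁴` for the cube `Λ = x + sbox(R+1)` of side
`2R+3`, every `R ≥ 1` — the squared centre gradient of the harmonic extension of the exterior GFF has mean `O(R⁻⁴)` (flux energy `O(R⁻⁴)`, file 1). [folklore] -/
theorem gff_integral_centreGradient_sq_le (hν : IsDiscreteGFF ν (coordProc 4)) :
    ∃ v : ℝ, 0 < v ∧ ∀ (R : ℕ), 1 ≤ R → ∀ (j : Fin 4) (x : Site 4),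
      ∫ φ, ((φ (x + e j) - dirichletField ((sbox (R + 1)).image (fun z => x + z)) φ (x + e j)) -
           (φ x - dirichletField ((sbox (R + 1)).image (fun z => x + z)) φ x)) ^ 2 ∂ν ≤ v / (R : ℝ) ^ 4 := by
  obtain ⟨v, hv0, hv⟩ := exists_sq_integral_responseCarrier_le hν
  refine ⟨v, hv0, fun R hR j x => ?_⟩
  have h := hv R hR Unit (fun _ => j) (fun _ => x) (fun i i' hii => absurd (Subsingleton.elim i i') hii) (fun _ => 1)
  simp only [Finset.univ_unique, Finset.sum_singleton, one_mul, one_pow, mul_one] at h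
  have hRpos : (0 : ℝ) < (R : ℝ) ^ 4 := by positivity
  rw [le_div_iff₀ hRpos]
  have e1 : ∀ φ : Site 4 → ℝ, ((R : ℝ) ^ 2 *
      ((φ (x + e j) - dirichletField ((sbox (R + 1)).image (fun z => x + z)) φ (x + e j)) -
       (φ x - dirichletField ((sbox (R + 1)).image (fun z => x + z)) φ x))) ^ 2 =
      ((φ (x + e j) - dirichletField ((sbox (R + 1)).image (fun z => x + z)) φ (x + e j)) -
       (φ x - dirichletField ((sbox (R + 1)).image (fun z => x + z)) φ x)) ^ 2 * (R : ℝ) ^ 4 := fun φ => by ring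
  simp_rw [e1, integral_mul_const] at h
  exact h

/-- **(RM) in the free field — the response-moment law of the lattice GFF of `ℤ⁴`.**  There are ABSOLUTE constants `C₁ > 0` and `B` such that for
every `R ≥ 1`, every `n`, all directions `j_i` and centres `x_i ∈ ℤ⁴` (`i < n`) pairwise `2R+4`-separated in some coordinate, and every sub-family
`T`:
`∫ exp( Σ_{i∈T} (R⁴/C₁)·|Q_i − ∫Q_i dν| ) dν ≤ exp(B·#T)`,  `Q_i(φ) = (∇_{j_i}(φ − ψ^{Λ_i})(x_i))²`,
where `Λ_i = x_i + sbox(R+1)` is the cube of side `2R+3` centred at `x_i` and `φ − ψ^{Λ_i} = φ − dirichletField Λ_i φ` the harmonic extension into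
`Λ_i` of the field outside — by the domain Markov property (tree `DiscreteGFFMarkov`: `ψ^{Λ}` is independent of the boundary field with covariance
`G_Λ`) `Q_i + Var(∇_{j_i}ψ^{Λ_i}(x_i))` is the conditional expectation of the squared centre gradient `(∇_{j_i}φ(x_i))²` given the field off `Λ_i`,
i.e. the free-field analogue of the femto plane kernel `kerE_i`, and `∫Q_i dν ≤ v/R⁴` (`gff_integral_centreGradient_sq_le`) is its bounded reference
value.  This is the statement of the registered v5(α) stub body `ResponseMomentsDefs.ResponseMomentsOdd6SU2` (joint exponential response moments at
weight `R⁴/C₁`, constant `e^{B#T}`, all separated families, uniformly in the scale) with the Wilson state replaced by the massless lattice free field and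
the torus by `ℤ⁴`: the (RM)/(β-cl) currency is GAUSSIAN-CONSISTENT at every scale (contrast: rate-`R⁻⁴` RARITY currencies are Gaussian-inconsistent,
ceilings-p2 #54).  Proof = the (β-cl) architecture run in the free field: flux representation + energy inequality ⇒ operator bound (EM_lin) ⇒
Hubbard–Stratonovich (EM_Q) ⇒ (RM) with `C₁ = 4v`, `B = 1/4 + log(2√2)`. [cite: FriedliVelenik2017, Ch. 8 Thm. 8.21] -/
theorem gff_responseMoments (hν : IsDiscreteGFF ν (coordProc 4)) :
    ∃ C₁ B : ℝ, 0 < C₁ ∧ ∀ (R : ℕ), 1 ≤ R → ∀ (n : ℕ) (j : Fin n → Fin 4) (x : Fin n → Site 4),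
      (∀ i i' : Fin n, i ≠ i' → ∃ k : Fin 4, 2 * (R : ℤ) + 4 ≤ |x i k - x i' k|) → ∀ T : Finset (Fin n),
      ∫ φ, Real.exp (∑ i ∈ T, (R : ℝ) ^ 4 / C₁ *
        |((φ (x i + e (j i)) - dirichletField ((sbox (R + 1)).image (fun z => x i + z)) φ (x i + e (j i))) -
            (φ (x i) - dirichletField ((sbox (R + 1)).image (fun z => x i + z)) φ (x i))) ^ 2 -
          ∫ φ', ((φ' (x i + e (j i)) - dirichletField ((sbox (R + 1)).image (fun z => x i + z)) φ' (x i + e (j i))) -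
            (φ' (x i) - dirichletField ((sbox (R + 1)).image (fun z => x i + z)) φ' (x i))) ^ 2 ∂ν|) ∂ν ≤
        Real.exp (B * #T) := by
  classical
  obtain ⟨v, hv0, hv⟩ := gff_expSquareLaw hν
  obtain ⟨v', hv'0, hv'⟩ := gff_integral_centreGradient_sq_le hν
  -- one absolute variance scale `V ≥ v, v'`
  set V : ℝ := max v v' with hV
  have hVv : v ≤ V := le_max_left _ _
  have hVv' : v' ≤ V := le_max_right _ _
  have hV0 : 0 < V := hv0.trans_le hVv
  refine ⟨4 * V, 1 / 4 + Real.log (2 * Real.sqrt 2), by positivity, fun R hR n j x hsep T => ?_⟩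
  have hP := hν.1.isProbabilityMeasure
  have hRpos : (0 : ℝ) < (R : ℝ) ^ 4 := by positivity
  -- the sub-family indexed by `T`
  set lam : ℝ := 1 / (4 * V) with hlam
  have hlam0 : 0 ≤ lam := by positivity
  have h2 : 2 * lam * v < 1 := by
    rw [hlam]
    have : 2 * (1 / (4 * V)) * v = v / (2 * V) := by field_simp; ring
    rw [this, div_lt_one (by positivity)]
    linarith
  obtain ⟨hint, hbound⟩ := hv lam hlam0 h2 R hR T (fun i => j i) (fun i => x i)
    (fun i i' hii => hsep i i' fun h => hii (Subtype.ext h))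
  -- abbreviations
  set Q : Fin n → (Site 4 → ℝ) → ℝ := fun i φ =>
    ((φ (x i + e (j i)) - dirichletField ((sbox (R + 1)).image (fun z => x i + z)) φ (x i + e (j i))) -
      (φ (x i) - dirichletField ((sbox (R + 1)).image (fun z => x i + z)) φ (x i))) ^ 2 with hQ
  have hQ0 : ∀ i φ, 0 ≤ Q i φ := fun i φ => sq_nonneg _
  have hmean : ∀ i, ∫ φ, Q i φ ∂ν ≤ v' / (R : ℝ) ^ 4 := fun i => hv' R hR (j i) (x i)
  have hmean0 : ∀ i, 0 ≤ ∫ φ, Q i φ ∂ν := fun i => integral_nonneg (hQ0 i)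
  -- pointwise domination of the integrand
  set G : (Site 4 → ℝ) → ℝ := fun φ => Real.exp (lam * ∑ i : T, ((R : ℝ) ^ 2 *
    ((φ (x i + e (j i)) - dirichletField ((sbox (R + 1)).image (fun z => x i + z)) φ (x i + e (j i))) -
     (φ (x i) - dirichletField ((sbox (R + 1)).image (fun z => x i + z)) φ (x i)))) ^ 2) with hG
  have hdom : ∀ φ : Site 4 → ℝ, Real.exp (∑ i ∈ T, (R : ℝ) ^ 4 / (4 * V) * |Q i φ - ∫ φ', Q i φ' ∂ν|) ≤
      Real.exp (1 / 4 * #T) * G φ := by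
    intro φ
    rw [hG, ← Real.exp_add]
    refine Real.exp_le_exp.2 ?_
    have hsum : ∑ i : T, ((R : ℝ) ^ 2 *
        ((φ (x i + e (j i)) - dirichletField ((sbox (R + 1)).image (fun z => x i + z)) φ (x i + e (j i))) -
         (φ (x i) - dirichletField ((sbox (R + 1)).image (fun z => x i + z)) φ (x i)))) ^ 2 =
        ∑ i ∈ T, (R : ℝ) ^ 4 * Q i φ := by
      rw [← Finset.sum_coe_sort T]
      exact Finset.sum_congr rfl fun i _ => by simp only [hQ]; ring
    rw [hsum, Finset.mul_sum, show (1 : ℝ) / 4 * #T = ∑ _i ∈ T, (1 : ℝ) / 4 by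
      rw [Finset.sum_const, nsmul_eq_mul]; ring, ← Finset.sum_add_distrib]
    refine Finset.sum_le_sum fun i _ => ?_
    have hab : |Q i φ - ∫ φ', Q i φ' ∂ν| ≤ Q i φ + ∫ φ', Q i φ' ∂ν := by
      rw [abs_le]; constructor <;> linarith [hQ0 i φ, hmean0 i]
    have hm : (R : ℝ) ^ 4 * ∫ φ', Q i φ' ∂ν ≤ V := by
      have := hmean i
      rw [le_div_iff₀ hRpos] at this
      linarith
    calc (R : ℝ) ^ 4 / (4 * V) * |Q i φ - ∫ φ', Q i φ' ∂ν| ≤ (R : ℝ) ^ 4 / (4 * V) * (Q i φ + ∫ φ', Q i φ' ∂ν) := by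
          gcongr
      _ = lam * ((R : ℝ) ^ 4 * Q i φ) + ((R : ℝ) ^ 4 * ∫ φ', Q i φ' ∂ν) / (4 * V) := by rw [hlam]; ring
      _ ≤ lam * ((R : ℝ) ^ 4 * Q i φ) + V / (4 * V) := by gcongr
      _ = 1 / 4 + lam * ((R : ℝ) ^ 4 * Q i φ) := by field_simp; ring
  -- integrate
  have hGint : Integrable (fun φ => Real.exp (1 / 4 * #T) * G φ) ν := hint.const_mul _
  calc ∫ φ, Real.exp (∑ i ∈ T, (R : ℝ) ^ 4 / (4 * V) * |Q i φ - ∫ φ', Q i φ' ∂ν|) ∂ν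
      ≤ ∫ φ, Real.exp (1 / 4 * #T) * G φ ∂ν :=
        integral_mono_of_nonneg (Filter.Eventually.of_forall fun φ => (Real.exp_pos _).le) hGint
          (Filter.Eventually.of_forall hdom)
    _ = Real.exp (1 / 4 * #T) * ∫ φ, G φ ∂ν := integral_const_mul _ _
    _ ≤ Real.exp (1 / 4 * #T) * (2 * Real.sqrt (1 / (1 - 2 * (lam * v)))) ^ Fintype.card T := by gcongr
    _ ≤ Real.exp (1 / 4 * #T) * (2 * Real.sqrt 2) ^ Fintype.card T := by
        have hlv : lam * v ≤ 1 / 4 := by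
          rw [hlam, div_mul_eq_mul_div, one_mul, div_le_iff₀ (by positivity)]
          linarith
        gcongr
        rw [div_le_iff₀ (by linarith)]
        linarith
    _ = Real.exp ((1 / 4 + Real.log (2 * Real.sqrt 2)) * #T) := by
        rw [Fintype.card_coe, add_mul, Real.exp_add, ← Real.exp_log (by positivity : (0:ℝ) < 2 * Real.sqrt 2),
          ← Real.exp_nat_mul, Real.exp_log (by positivity : (0:ℝ) < 2 * Real.sqrt 2)]
        ring_nf

end Law

end Summit.QuantumFields.YangMills.Cruxes.UVSeamRec.GaussianCalibration

end
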